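import Mathlib
import Literature.NumberTheory.Irrationality.Fischler2002.JnFinitenessUpperProofs
import Literature.NumberTheory.Irrationality.Fischler2002.KLSubstitutionProofs
import HarnessLib

/-!
# The finiteness criterion for Fischler's Sorokin-type family `𝓛(P)` — I: peeling the last variable (upper bounds)

Topic `Literature/NumberTheory/Irrationality/Fischler2002`; proofs-only companion of `BeukersSorokinChangeOfVariables.lean`
(the §2 file: `headProduct`, `integrandL`, `L`). Source: S. Fischler, « Formes linéaires en polyzêtas et intégrales
multiples », C. R. Acad. Sci. Paris Sér. I **335** (2002) 1–4 = arXiv:math/0202064 [Fischler2002Polyzetas], §2 p. 3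
(read on the page, `paper:arxiv-math_0202064` p. 3): "à tout `P = (A₁,…,A_n,B₁,…,B_n,C₂,…,C_n) ∈ ℤ^{3n−1}` on associe
`𝓛(P) = ∫_{[0,1]^n} ∏_{k=1}^n X_k^{A_k}(1−X_k)^{B_k} / ∏_{k=2}^n (1 − X₁X₂…X_k)^{C_k+1} dX₁…dX_n`. Cette intégrale est
finie [si et seulement si] on a `Σ_{k=2}^{n} (C_k − B_k)⁺ ≤ B₁` et `A_k ≥ 0`, `B_k ≥ 0` pour tout `k`." The journal version,
S. Fischler, *Groupes de Rhin-Viola et intégrales multiples*, J. Théor. Nombres Bordeaux **15** (2003) 479–534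
[Fischler2003RhinViola], §5.2 Proposition 16, footnote 3, CORRECTS this remark (« Noter l'erreur, à ce propos, dans [6] »);
the corrected wording is not held by the tree's library (acquisition request acq-09250). The statement file therefore typed
NO criterion for `𝓛`; this file and `LFinitenessCriterionProofs.lean` DERIVE AND PROVE one (cell `pub-zeta5`, seat ct-1 g33,
2026-08-27): `𝓛(P) < ∞` iff `A_k ≥ 0`, `B_k ≥ 0` for all `k ≤ n` and `Σ_{k=2}^{j} (C_k − B_k) ≤ B₁` for every
`j ∈ {2,…,n}` — and show that the note's printed condition is sufficient but NOT necessary.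

HONEST FRAMING (cells pub-zeta5 / zeta5-irr): systematic search; no irrationality claim unless certified. Real analysis
only (Tonelli and one-variable estimates for integrals of non-negative functions); nothing about `ζ(5)`.

## The peeling (this file)
The last variable `X_m = t` enters `𝓛` through the Euler kernel `t^α(1−t)^β(1 − t·Π_{m−1})^{−γ}`, `Π_{m−1} = X₁⋯X_{m−1}`
(`headProduct`), so the one-variable bounds of `EulerKernelBoundsProofs.lean` (seat ct-1 g32) apply with `δ = Π_{m−1}`.
The peeled integrand with REAL exponent functions `α, β, γ, r : ℕ → ℝ`,
`Ψ_m = ∏_{k ≤ m} X_k^{α_k}(1−X_k)^{β_k}(1−Π_k)^{−γ_k} · (1−Π_m)^{−r_{m+1}}` (spelled inline — NO definition),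
reproduces itself exactly under `∫₀¹ … dt ≤ C(1−Π_{m−1})^{−r_m}`; one induction on `m` (`lintegral_psi_lt_top`). On the open
cube `integrandL` is the product part of `Ψ_n` with `α = A`, `β = B`, `γ₁ = 0`, `γ_k = C_k + 1` (`integrandL_eq_rpow_prod`).
Theorems only, no definition, no new named fact.
-/

noncomputable section

namespace Literature.NumberTheory.Irrationality.Fischler2002

open MeasureTheory Set Finset JnChi KL JnFinite
open scoped ENNReal

namespace LFinite

/-! ### Head products on the open cube -/

/-- On the open cube, `0 < 1 − Π_k ≤ 1` for `1 ≤ k ≤ m`… precisely `0 < 1 − Π_k` and `1 − Π_k < 1`.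
[cite: Fischler2002Polyzetas, §2 p. 3 (definition of 𝓛(P))] -/
theorem one_sub_headProduct_mem {m : ℕ} {X : Fin m → ℝ} (hX : ∀ i, 0 < X i ∧ X i < 1) {k : ℕ} (hk1 : 1 ≤ k)
    (hkm : k ≤ m) : 0 < 1 - headProduct X k ∧ 1 - headProduct X k < 1 := by
  obtain ⟨h0, -, h1⟩ := headProduct_mem hX k hkm
  exact ⟨by linarith [h1 hk1], by linarith⟩

/-- `Π₁ = X₁`. [cite: Fischler2002Polyzetas, §2 p. 3 (definition of 𝓛(P))] -/
theorem headProduct_one {m : ℕ} (X : Fin m → ℝ) : headProduct X 1 = coord X 1 := by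
  rw [show (1 : ℕ) = 0 + 1 from rfl, headProduct_succ, headProduct_zero, one_mul]

/-! ### The real-exponent integrand `Ψ`: measurability, positivity, fibre form -/

/-- Measurability of `Ψ_m = ∏_{k≤m} X_k^{α_k}(1−X_k)^{β_k}(1−Π_k)^{−γ_k} · (1−Π_m)^{−r_{m+1}}`.
[cite: Fischler2002Polyzetas, §2 p. 3 (critère de finitude de 𝓛)] -/
theorem measurable_psi (α β γ r : ℕ → ℝ) (m : ℕ) :
    Measurable fun X : Fin m → ℝ =>
      (∏ k ∈ Icc 1 m, coord X k ^ α k * (1 - coord X k) ^ β k * (1 - headProduct X k) ^ (-γ k)) *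
        (1 - headProduct X m) ^ (-r (m + 1)) := by
  refine (Finset.measurable_prod _ fun k _ => ?_).mul ((measurable_const.sub (measurable_headProduct m)).pow_const _)
  exact (((measurable_coord k).pow_const _).mul ((measurable_const.sub (measurable_coord k)).pow_const _)).mul
    ((measurable_const.sub (measurable_headProduct k)).pow_const _)

/-- The product part of `Ψ` is positive on the open cube. [cite: Fischler2002Polyzetas, §2 p. 3 (critère de finitude de 𝓛)] -/
theorem psiProd_pos (α β γ : ℕ → ℝ) {m : ℕ} {X : Fin m → ℝ} (hX : ∀ i, 0 < X i ∧ X i < 1) :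
    0 < ∏ k ∈ Icc 1 m, coord X k ^ α k * (1 - coord X k) ^ β k * (1 - headProduct X k) ^ (-γ k) := by
  refine Finset.prod_pos fun k hk => ?_
  have hk' := Finset.mem_Icc.1 hk
  obtain ⟨h0, h1⟩ := coord_mem hX hk'.1 hk'.2
  have hd := (one_sub_headProduct_mem hX hk'.1 hk'.2).1
  exact mul_pos (mul_pos (Real.rpow_pos_of_pos h0 _) (Real.rpow_pos_of_pos (by linarith) _)) (Real.rpow_pos_of_pos hd _)

/-- `Ψ_m` is positive on the open cube (`m ≥ 1`). [cite: Fischler2002Polyzetas, §2 p. 3 (critère de finitude de 𝓛)] -/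
theorem psi_pos (α β γ r : ℕ → ℝ) {m : ℕ} (hm : 1 ≤ m) {X : Fin m → ℝ} (hX : ∀ i, 0 < X i ∧ X i < 1) :
    0 < (∏ k ∈ Icc 1 m, coord X k ^ α k * (1 - coord X k) ^ β k * (1 - headProduct X k) ^ (-γ k)) *
        (1 - headProduct X m) ^ (-r (m + 1)) :=
  mul_pos (psiProd_pos α β γ hX) (Real.rpow_pos_of_pos (one_sub_headProduct_mem hX hm le_rfl).1 _)

/-- **Fibre form of `Ψ`**: for `X′ ∈ (0,1)^m` and `t ∈ (0,1)`,
`Ψ_{m+1}(X′, t) = [∏_{k≤m}(…)(X′)] · t^{α_{m+1}}(1−t)^{β_{m+1}}(1 − t·Π_m(X′))^{−(γ_{m+1}+r_{m+2})}`.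
[cite: Fischler2002Polyzetas, §2 p. 3 (critère de finitude de 𝓛)] -/
theorem psi_snoc (α β γ r : ℕ → ℝ) {m : ℕ} {X' : Fin m → ℝ} (hX : ∀ i, 0 < X' i ∧ X' i < 1)
    {t : ℝ} (ht : t ∈ Ioo (0 : ℝ) 1) :
    (∏ k ∈ Icc 1 (m + 1), coord (Fin.snoc X' t : Fin (m + 1) → ℝ) k ^ α k *
          (1 - coord (Fin.snoc X' t : Fin (m + 1) → ℝ) k) ^ β k *
          (1 - headProduct (Fin.snoc X' t : Fin (m + 1) → ℝ) k) ^ (-γ k)) *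
        (1 - headProduct (Fin.snoc X' t : Fin (m + 1) → ℝ) (m + 1)) ^ (-r (m + 1 + 1)) =
      (∏ k ∈ Icc 1 m, coord X' k ^ α k * (1 - coord X' k) ^ β k * (1 - headProduct X' k) ^ (-γ k)) *
        (t ^ α (m + 1) * (1 - t) ^ β (m + 1) * (1 - t * headProduct X' m) ^ (-(γ (m + 1) + r (m + 2)))) := by
  obtain ⟨-, hP1, -⟩ := headProduct_mem hX m le_rfl
  have hden : 0 < 1 - t * headProduct X' m := by nlinarith [mul_le_mul_of_nonneg_left hP1 ht.1.le, ht.2]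
  rw [Finset.prod_Icc_succ_top (by omega : 1 ≤ m + 1), coord_snoc_last, headProduct_snoc_last,
    show m + 1 + 1 = m + 2 from rfl]
  have hP : ∏ k ∈ Icc 1 m, coord (Fin.snoc X' t : Fin (m + 1) → ℝ) k ^ α k *
        (1 - coord (Fin.snoc X' t : Fin (m + 1) → ℝ) k) ^ β k *
        (1 - headProduct (Fin.snoc X' t : Fin (m + 1) → ℝ) k) ^ (-γ k) =
      ∏ k ∈ Icc 1 m, coord X' k ^ α k * (1 - coord X' k) ^ β k * (1 - headProduct X' k) ^ (-γ k) :=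
    Finset.prod_congr rfl fun k hk => by
      rw [coord_snoc_of_le X' t (Finset.mem_Icc.1 hk).2, headProduct_snoc_of_le X' t (Finset.mem_Icc.1 hk).2]
  have hcomm : headProduct X' m * t = t * headProduct X' m := mul_comm _ _
  rw [hP, hcomm, show -(γ (m + 1) + r (m + 2)) = -γ (m + 1) + (-r (m + 2)) by ring, Real.rpow_add hden]
  ring

/-- **`Ψ₁` is a Beta kernel**: for `t ∈ (0,1)` (and the empty tuple `X′`), `Ψ₁(X′, t) = t^{α₁}(1−t)^{β₁−γ₁−r₂}`.
[cite: Fischler2002Polyzetas, §2 p. 3 (critère de finitude de 𝓛)] -/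
theorem psi_one (α β γ r : ℕ → ℝ) (X' : Fin 0 → ℝ) {t : ℝ} (ht : t ∈ Ioo (0 : ℝ) 1) :
    (∏ k ∈ Icc 1 (0 + 1), coord (Fin.snoc X' t : Fin (0 + 1) → ℝ) k ^ α k *
          (1 - coord (Fin.snoc X' t : Fin (0 + 1) → ℝ) k) ^ β k *
          (1 - headProduct (Fin.snoc X' t : Fin (0 + 1) → ℝ) k) ^ (-γ k)) *
        (1 - headProduct (Fin.snoc X' t : Fin (0 + 1) → ℝ) (0 + 1)) ^ (-r (0 + 1 + 1)) =
      t ^ α 1 * (1 - t) ^ (β 1 - γ 1 - r 2) := by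
  have hX : ∀ i : Fin 0, 0 < X' i ∧ X' i < 1 := fun i => i.elim0
  have h1' : 0 < 1 - t := by linarith [ht.2]
  rw [psi_snoc α β γ r hX ht, Finset.Icc_eq_empty (by omega), Finset.prod_empty, one_mul, headProduct_zero, mul_one,
    show (0 + 1 : ℕ) = 1 from rfl, show (0 + 2 : ℕ) = 2 from rfl,
    show β 1 - γ 1 - r 2 = β 1 + (-(γ 1 + r 2)) by ring, Real.rpow_add h1']
  ring

/-! ### The induction on the number of variables -/

/-- **Finiteness of the peeled integrals.** For real exponent functions `α, β, γ, r` with `r ≥ 0`, `α_k > −1`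
(`1 ≤ k ≤ n`), `β_k > −1` and `γ_k + r_{k+1} − β_k − 1 < r_k` (`2 ≤ k ≤ n`), and `β₁ − γ₁ − r₂ > −1`, every `Ψ_m`
(`1 ≤ m ≤ n`) has finite integral over `(0,1)^m` — induction on `m`, integrating the last variable by the Euler-kernel
upper bound with `δ = Π_{m−1}`. [cite: Fischler2002Polyzetas, §2 p. 3 (critère de finitude de 𝓛)] -/
theorem lintegral_psi_lt_top (n : ℕ) (α β γ r : ℕ → ℝ) (hr : ∀ k, 0 ≤ r k)
    (hα : ∀ k, 1 ≤ k → k ≤ n → -1 < α k) (hβ : ∀ k, 2 ≤ k → k ≤ n → -1 < β k)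
    (hγ : ∀ k, 2 ≤ k → k ≤ n → γ k + r (k + 1) - β k - 1 < r k) (h1 : -1 < β 1 - γ 1 - r 2) :
    ∀ m, 1 ≤ m → m ≤ n →
      ∫⁻ X in (Set.pi Set.univ fun _ : Fin m => Ioo (0 : ℝ) 1),
        ENNReal.ofReal ((∏ k ∈ Icc 1 m, coord X k ^ α k * (1 - coord X k) ^ β k * (1 - headProduct X k) ^ (-γ k)) *
          (1 - headProduct X m) ^ (-r (m + 1))) < ∞ := by
  intro m hm hmn
  induction m with
  | zero => omega
  | succ m ih =>
    rcases Nat.eq_zero_or_pos m with rfl | hmpos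
    · -- one variable: a Beta integral
      rw [lintegral_openCube_succ _ (measurable_psi α β γ r (0 + 1)).ennreal_ofReal]
      have hinner : ∀ X' : Fin 0 → ℝ,
          ∫⁻ t in Ioo (0 : ℝ) 1, ENNReal.ofReal
            ((∏ k ∈ Icc 1 (0 + 1), coord (Fin.snoc X' t : Fin (0 + 1) → ℝ) k ^ α k *
                (1 - coord (Fin.snoc X' t : Fin (0 + 1) → ℝ) k) ^ β k *
                (1 - headProduct (Fin.snoc X' t : Fin (0 + 1) → ℝ) k) ^ (-γ k)) *
              (1 - headProduct (Fin.snoc X' t : Fin (0 + 1) → ℝ) (0 + 1)) ^ (-r (0 + 1 + 1))) =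
            ∫⁻ t in Ioo (0 : ℝ) 1, ENNReal.ofReal (t ^ α 1 * (1 - t) ^ (β 1 - γ 1 - r 2)) := by
        intro X'
        refine setLIntegral_congr_fun measurableSet_Ioo fun t ht => ?_
        rw [psi_one α β γ r X' ht]
      simp only [hinner]
      rw [setLIntegral_const, volume_openCube, mul_one]
      exact lintegral_beta_lt_top (hα 1 le_rfl (by omega)) h1
    · -- peel the last variable
      have ih' := ih hmpos (by omega)
      obtain ⟨C, hC, hCb⟩ := lintegral_eulerKernel_le (α := α (m + 1)) (β := β (m + 1))
        (γ := γ (m + 1) + r (m + 2)) (r := r (m + 1)) (hα (m + 1) (by omega) hmn)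
        (hβ (m + 1) (by omega) hmn) (hr (m + 1)) (by have := hγ (m + 1) (by omega) hmn; linarith)
      rw [lintegral_openCube_succ _ (measurable_psi α β γ r (m + 1)).ennreal_ofReal]
      calc ∫⁻ X' in (Set.pi Set.univ fun _ : Fin m => Ioo (0 : ℝ) 1), ∫⁻ t in Ioo (0 : ℝ) 1, ENNReal.ofReal
              ((∏ k ∈ Icc 1 (m + 1), coord (Fin.snoc X' t : Fin (m + 1) → ℝ) k ^ α k *
                  (1 - coord (Fin.snoc X' t : Fin (m + 1) → ℝ) k) ^ β k *
                  (1 - headProduct (Fin.snoc X' t : Fin (m + 1) → ℝ) k) ^ (-γ k)) *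
                (1 - headProduct (Fin.snoc X' t : Fin (m + 1) → ℝ) (m + 1)) ^ (-r (m + 1 + 1)))
          ≤ ∫⁻ X' in (Set.pi Set.univ fun _ : Fin m => Ioo (0 : ℝ) 1), C * ENNReal.ofReal
              ((∏ k ∈ Icc 1 m, coord X' k ^ α k * (1 - coord X' k) ^ β k * (1 - headProduct X' k) ^ (-γ k)) *
                (1 - headProduct X' m) ^ (-r (m + 1))) := by
            refine setLIntegral_mono' (measurableSet_openCube m) fun X' hX' => ?_
            have hX := mem_openCube_iff.1 hX'
            obtain ⟨hP0, -, hP1⟩ := headProduct_mem hX m le_rfl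
            have hP1' := hP1 hmpos
            set G : ℝ := ∏ k ∈ Icc 1 m, coord X' k ^ α k * (1 - coord X' k) ^ β k * (1 - headProduct X' k) ^ (-γ k)
              with hG
            have hG0 : 0 ≤ G := by rw [hG]; exact (psiProd_pos α β γ hX).le
            calc ∫⁻ t in Ioo (0 : ℝ) 1, ENNReal.ofReal
                  ((∏ k ∈ Icc 1 (m + 1), coord (Fin.snoc X' t : Fin (m + 1) → ℝ) k ^ α k *
                      (1 - coord (Fin.snoc X' t : Fin (m + 1) → ℝ) k) ^ β k *
                      (1 - headProduct (Fin.snoc X' t : Fin (m + 1) → ℝ) k) ^ (-γ k)) *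
                    (1 - headProduct (Fin.snoc X' t : Fin (m + 1) → ℝ) (m + 1)) ^ (-r (m + 1 + 1)))
                = ∫⁻ t in Ioo (0 : ℝ) 1, ENNReal.ofReal G * ENNReal.ofReal
                    (t ^ α (m + 1) * (1 - t) ^ β (m + 1) *
                      (1 - t * headProduct X' m) ^ (-(γ (m + 1) + r (m + 2)))) := by
                  refine setLIntegral_congr_fun measurableSet_Ioo fun t ht => ?_
                  rw [psi_snoc α β γ r hX ht, ← hG, ENNReal.ofReal_mul hG0]
              _ = ENNReal.ofReal G * ∫⁻ t in Ioo (0 : ℝ) 1, ENNReal.ofReal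
                    (t ^ α (m + 1) * (1 - t) ^ β (m + 1) *
                      (1 - t * headProduct X' m) ^ (-(γ (m + 1) + r (m + 2)))) :=
                  lintegral_const_mul' _ _ ENNReal.ofReal_ne_top
              _ ≤ ENNReal.ofReal G * (C * ENNReal.ofReal ((1 - headProduct X' m) ^ (-r (m + 1)))) :=
                  mul_le_mul' le_rfl (hCb _ hP0.le hP1')
              _ = C * ENNReal.ofReal (G * (1 - headProduct X' m) ^ (-r (m + 1))) := by
                  rw [ENNReal.ofReal_mul hG0]; ring
        _ = C * ∫⁻ X' in (Set.pi Set.univ fun _ : Fin m => Ioo (0 : ℝ) 1), ENNReal.ofReal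
              ((∏ k ∈ Icc 1 m, coord X' k ^ α k * (1 - coord X' k) ^ β k * (1 - headProduct X' k) ^ (-γ k)) *
                (1 - headProduct X' m) ^ (-r (m + 1))) :=
            lintegral_const_mul' _ _ hC
        _ < ∞ := ENNReal.mul_lt_top hC.lt_top ih'

/-! ### From `𝓛(P)` to `Ψ`: the integrand on the open cube -/

/-- **The integrand of `𝓛(P)` on the open cube, with real exponents**: for `n ≥ 1` and `X ∈ (0,1)^n`,
`integrandL n P X = ∏_{k=1}^{n} X_k^{A_k}(1−X_k)^{B_k}(1−Π_k)^{−γ_k}` with `γ₁ = 0` and `γ_k = C_k + 1` (`k ≥ 2`).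
[cite: Fischler2002Polyzetas, §2 p. 3 (definition of 𝓛(P))] -/
theorem integrandL_eq_rpow_prod {n : ℕ} (hn : 1 ≤ n) (P : Exponents) {X : Fin n → ℝ}
    (hX : ∀ i, 0 < X i ∧ X i < 1) :
    integrandL n P X = ∏ k ∈ Icc 1 n, coord X k ^ (P.a k : ℝ) * (1 - coord X k) ^ (P.b k : ℝ) *
      (1 - headProduct X k) ^ (-(if k = 1 then (0 : ℝ) else ((P.c k : ℝ) + 1))) := by
  unfold integrandL
  simp_rw [← Real.rpow_intCast]
  conv_rhs => rw [Finset.prod_mul_distrib]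
  have hpos : ∀ k, 1 ≤ k → k ≤ n → 0 < 1 - headProduct X k := fun k hk1 hkn => (one_sub_headProduct_mem hX hk1 hkn).1
  have hD : ∏ k ∈ Icc 1 n, (1 - headProduct X k) ^ (-(if k = 1 then (0 : ℝ) else ((P.c k : ℝ) + 1))) =
      (∏ k ∈ Icc 2 n, (1 - headProduct X k) ^ (((P.c k + 1 : ℤ)) : ℝ))⁻¹ := by
    rw [prod_Icc_one_eq_mul hn, if_pos rfl, neg_zero, Real.rpow_zero, one_mul, ← Finset.prod_inv_distrib]
    refine Finset.prod_congr rfl fun k hk => ?_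
    have hk' := Finset.mem_Icc.1 hk
    rw [if_neg (by omega), Real.rpow_neg (hpos k (by omega) hk'.2).le]
    push_cast
    ring_nf
  rw [hD, div_eq_mul_inv]

/-- The extra factor of `Ψ_n` is `≥ 1` on the open cube (`n ≥ 1`, `r_{n+1} ≥ 0`), so the product part is at most
`Ψ_n`. [cite: Fischler2002Polyzetas, §2 p. 3 (critère de finitude de 𝓛)] -/
theorem prod_le_psi (α β γ r : ℕ → ℝ) {n : ℕ} (hr : 0 ≤ r (n + 1)) (hn : 1 ≤ n) {X : Fin n → ℝ}
    (hX : ∀ i, 0 < X i ∧ X i < 1) :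
    (∏ k ∈ Icc 1 n, coord X k ^ α k * (1 - coord X k) ^ β k * (1 - headProduct X k) ^ (-γ k)) ≤
      (∏ k ∈ Icc 1 n, coord X k ^ α k * (1 - coord X k) ^ β k * (1 - headProduct X k) ^ (-γ k)) *
        (1 - headProduct X n) ^ (-r (n + 1)) := by
  refine le_mul_of_one_le_right (psiProd_pos α β γ hX).le ?_
  obtain ⟨h0, h1⟩ := one_sub_headProduct_mem hX hn le_rfl
  exact Real.one_le_rpow_of_pos_of_le_one_of_nonpos h0 h1.le (by linarith)

end LFinite

end Literature.NumberTheory.Irrationality.Fischler2002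

end
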